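import Summits.BirchSwinnertonDyer.Rank1Residual.Additive.SignedTwistMinusLineShapePadic
import Summits.BirchSwinnertonDyer.Rank1Residual.Additive.PadicLogImage
import Summits.BirchSwinnertonDyer.Rank1Residual.Additive.LocalKummerOrder
import HarnessLib

/-!
# The Kummer group of `W(ℚ_p)` in `H¹(ℚ_p, W[p^m])`: order `p^m`, a class of order `p^m`, Kummer
# cocycles of rational points — and B3 in level-`m` shape for the signed twist modulo ONLY
# `#H¹(ℚ_p, W[p^m])[p] ≤ p²` (cell `b2b-bsdres`, CLASS-CLOSURE lane, class O10 — x1b GEN 40, class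
# lead; file 96 of the series)

HONEST FRAMING (cell `b2b-bsdres`, run/shared/lean/b2b/bsd-rank1-residual/, verbatim in every
file): the goal of the cell is to DELETE the COMBINATION-SHAPED residual classes of the
Birch–Swinnerton-Dyer formula for ALL analytic-rank `≤ 1` elliptic curves over `ℚ` — "full BSD
formula for every rank `≤ 1` curve in class `C`" assembled STRICTLY from published theorems — so
that the rank-`≤ 1` remainder becomes exactly the CONSTRUCTION-SHAPED classes, which are TYPED
(missing-input `Prop`s), NOT attempted. This is not "finishing BSD". CLASS-CLOSURE lane: prove
what is provable now; shrink each hard class to its core with data; no claim beyond stated classes;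
research routes on CONSTRUCTION-SHAPED X12 / O10; census / instrument output = EVIDENCE / conjecture
items, NEVER a Literature fact; `RESIDUAL-MAP.md` marks change only by signed lines. THIS FILE:
TOOL THEOREMS ONLY — no definition, no named Literature fact, no `sorry`, axioms standard; nothing
is booked; no label / mark / count / sub-cell moves; (C1_η), (C2_η-GZ), (C3_η) stay typed as filed
(cc-typer-6's pen); nothing about `BSD(W, p)` of any pair is claimed.

## What

File 95 left B3 in level-`m` shape modulo `#H¹(ℚ_p, W[p^m])[p] ≤ p²` and the KUMMER-GROUP DATA
(a subgroup of order `p^m` with an element of order `p^m` whose classes are Kummer cocycles of points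
of `W(ℚ_p)`). This file supplies the Kummer-group data at the model `ℚ_[p]` for the Literature's
local Kummer map `W.localKummerMap ℚ_[p]` (exact, `ker_localKummerMap`):

* §1 `natCard_quotient_eq_prime_pow_of_log` (pure algebra): an abelian group `A` without `p`-torsion
  carrying a homomorphism `f : A → ℚ_p` whose kernel is torsion and whose image is a line `ℤ_p·c`
  (`c ≠ 0`) has `#(A/N) = p^m` for the subgroup `N = p^m A`, and contains `a₀` with `f a₀ = c`,
  `a₀ ∉ pA` (torsion without `p`-torsion is `p`-divisible; `A/p^m A ≅ ℤ_p/p^m`).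
* §2 For a `p`-integral elliptic `W/ℚ` with `W(ℚ_p)[p] = 0`: `f = padicLog` (x1b's
  `PadicLogImage`: kernel = torsion, image `= p^k ℤ_p`) gives **`#𝓚 = p^m`** for
  `𝓚 = range (localKummerMap)` (`natCard_range_localKummerMap`), **a class of order `p^m`**
  (`LocalKummerOrder.addOrderOf_localKummerMap_eq` at level `ν = 0`), and every class of `𝓚` is
  represented by a Kummer cocycle `u ↦ uR′ − R′` with `p^m R′` a `Γ_{ℚ_p}`-fixed point
  (`pointsMap_localKummerCocycle_apply`).
* §3 **`closure_minus_sup_range_localKummerMap_eq_top_cyclotomic`**: B3 in level-`m` shape for the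
  `p*`-twist in Kobayashi's setting with `K = 𝓚` the Kummer group — modulo ONLY
  `#H¹(ℚ_p, W[p^m])[p] ≤ p²` (local duality + Euler characteristic, fact-shaped) and the `p`-integrality
  of `W`'s equation; `W(ℚ_p)[p] = 0` is discharged (`eq_zero_of_prime_smul_eq_zero_padic_of_quadraticTwist_signedPrime`).

References: [Kobayashi2003] Thm. 6.2 (p. 11); [SilvermanAEC2009] IV.6.4, VII.6.3, VIII.§2;
[GreenbergLNM1716] §2 pp. 62–63.
-/

noncomputable section

open scoped Classical

open WeierstrassCurve Field

namespace Summit.BirchSwinnertonDyer.Rank1Residual.Additive.SignedTwist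

open Literature.NumberTheory.EllipticCurves Literature.NumberTheory.GaloisRepresentations
  Literature.NumberTheory.EllipticCurves.Kobayashi2003 Literature.NumberTheory.EllipticCurves.ZpDescent
  Summit.BirchSwinnertonDyer.Rank1Residual.AdditivePotMult
  Summit.BirchSwinnertonDyer.Rank1Residual.Additive.PadicCyclotomicTower
  ZpExtension
open scoped ContRepresentation

/-! ## §1 Pure algebra: `#(A / p^m A) = p^m` from a logarithm onto a `ℤ_p`-line -/

/-- Torsion elements of a group without `p`-torsion are `p^m`-divisible. [folklore] -/
theorem exists_pow_smul_eq_of_isOfFinAddOrder {A : Type*} [AddCommGroup A] {p : ℕ} (hp : p.Prime)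
    (htors : ∀ a : A, p • a = 0 → a = 0) (m : ℕ) {t : A} (ht : IsOfFinAddOrder t) :
    ∃ s : A, p ^ m • s = t := by
  set n := addOrderOf t with hn
  have hn0 : 0 < n := ht.addOrderOf_pos
  have hcop : Nat.Coprime p n := by
    rw [Nat.Prime.coprime_iff_not_dvd hp]
    rintro ⟨k, hk⟩
    have hk0 : 0 < k := Nat.pos_of_ne_zero fun h => by rw [h, mul_zero] at hk; omega
    have hs : p • (k • t) = 0 := by rw [← mul_nsmul', ← hk, hn, addOrderOf_nsmul_eq_zero]
    have hkt : k • t = 0 := htors _ hs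
    have hdvd : n ∣ k := hn ▸ addOrderOf_dvd_of_nsmul_eq_zero hkt
    have hle := Nat.le_of_dvd hk0 hdvd
    have : n = p * k := hk
    nlinarith [hp.two_le]
  obtain ⟨u, v, huv⟩ := Nat.isCoprime_iff_coprime.mpr (Nat.Coprime.pow_left m hcop)
  refine ⟨u • t, ?_⟩
  have h1 : t = (u * (p ^ m : ℕ) + v * (n : ℕ)) • t := by rw [huv, one_zsmul]
  conv_rhs => rw [h1]
  rw [add_zsmul, mul_zsmul, mul_zsmul, natCast_zsmul, natCast_zsmul, hn, addOrderOf_nsmul_eq_zero,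
    zsmul_zero, add_zero, smul_comm]

/-- **`#(A / p^m A) = p^m` and a level-`0` element from a logarithm onto a `ℤ_p`-line.** `A` abelian
without `p`-torsion, `f : A →+ ℚ_p` with torsion kernel and image `{r·c : r ∈ ℤ_p}` (`c ≠ 0`), `N` the
subgroup `p^m A`: `#(A/N) = p^m`, and some `a₀` has `f a₀ = c` and `a₀ ∉ pA`. [folklore] -/
theorem natCard_quotient_eq_prime_pow_of_log {A : Type*} [AddCommGroup A] {p : ℕ} [hp : Fact p.Prime]
    (f : A →+ ℚ_[p]) {c : ℚ_[p]} (hc : c ≠ 0) (hker : ∀ a, f a = 0 → IsOfFinAddOrder a)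
    (hrange : ∀ y : ℚ_[p], (∃ a, f a = y) ↔ ∃ r : ℤ_[p], (r : ℚ_[p]) * c = y)
    (htors : ∀ a : A, p • a = 0 → a = 0) (m : ℕ) (N : AddSubgroup A)
    (hN : ∀ a, a ∈ N ↔ ∃ b : A, ((p ^ m : ℕ) : ℤ) • b = a) :
    Nat.card (A ⧸ N) = p ^ m ∧ ∃ a₀ : A, f a₀ = c ∧ ∀ b : A, p • b ≠ a₀ := by
  -- the coordinate `ψ : A → ℤ_p`, `ψ a · c = f a`
  have hψex : ∀ a, ∃ r : ℤ_[p], (r : ℚ_[p]) * c = f a := fun a => (hrange (f a)).mp ⟨a, rfl⟩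
  choose ψ hψ using hψex
  have huniq : ∀ r s : ℤ_[p], (r : ℚ_[p]) * c = (s : ℚ_[p]) * c → r = s := fun r s h =>
    Subtype.ext (mul_right_cancel₀ hc h)
  have hadd : ∀ a b, ψ (a + b) = ψ a + ψ b := fun a b =>
    huniq _ _ (by rw [hψ, map_add, PadicInt.coe_add, add_mul, hψ, hψ])
  set Ψ : A →+ ℤ_[p] := AddMonoidHom.mk' ψ hadd with hΨ
  have hΨapp : ∀ a, Ψ a = ψ a := fun a => rfl
  have hΨsurj : Function.Surjective Ψ := fun r => by
    obtain ⟨a, ha⟩ := (hrange ((r : ℚ_[p]) * c)).mpr ⟨r, rfl⟩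
    exact ⟨a, huniq _ _ (by rw [hΨapp, hψ, ha])⟩
  have hΨker : ∀ a, Ψ a = 0 → IsOfFinAddOrder a := fun a ha => hker a (by
    rw [← hψ a, ← hΨapp, ha, PadicInt.coe_zero, zero_mul])
  -- `θ : A → ℤ_p/p^m`
  set θ : A →+ ZMod (p ^ m) := (PadicInt.toZModPow m).toAddMonoidHom.comp Ψ with hθ
  have hθsurj : Function.Surjective θ :=
    (ZMod.ringHom_surjective (PadicInt.toZModPow m)).comp hΨsurj
  have hθker : ∀ a, a ∈ θ.ker ↔ a ∈ N := by
    intro a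
    rw [AddMonoidHom.mem_ker, hN]
    change PadicInt.toZModPow m (Ψ a) = 0 ↔ _
    rw [← RingHom.mem_ker, PadicInt.ker_toZModPow, Ideal.mem_span_singleton]
    constructor
    · rintro ⟨r, hr⟩
      obtain ⟨b, hb⟩ := hΨsurj r
      have h0 : Ψ (a - (p ^ m : ℕ) • b) = 0 := by
        rw [map_sub, map_nsmul, hb, hr, nsmul_eq_mul, Nat.cast_pow, sub_self]
      obtain ⟨s, hs⟩ := exists_pow_smul_eq_of_isOfFinAddOrder hp.out htors m (hΨker _ h0)
      refine ⟨b + s, ?_⟩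
      rw [natCast_zsmul, smul_add, hs, add_sub_cancel]
    · rintro ⟨b, rfl⟩
      exact ⟨Ψ b, by rw [map_zsmul, zsmul_eq_mul, Int.cast_natCast, Nat.cast_pow]⟩
  have hkerEq : θ.ker = N := AddSubgroup.ext hθker
  refine ⟨?_, ?_⟩
  · rw [← hkerEq, Nat.card_congr (QuotientAddGroup.quotientKerEquivOfSurjective θ hθsurj).toEquiv,
      Nat.card_zmod]
  · obtain ⟨a₀, ha₀⟩ := hΨsurj 1
    refine ⟨a₀, by rw [← hψ a₀, ← hΨapp, ha₀, PadicInt.coe_one, one_mul], fun b hb => ?_⟩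
    have h1 : (p : ℤ_[p]) * Ψ b = 1 := by
      rw [← ha₀, ← hb, map_nsmul, nsmul_eq_mul]
    exact (PadicInt.irreducible_p (p := p)).not_isUnit (isUnit_iff_exists_inv.mpr ⟨Ψ b, h1⟩)

/-! ## §2 The Kummer group of `W(ℚ_p)` at the model `ℚ_[p]` -/

section Kummer

variable (W : WeierstrassCurve ℚ) [W.IsElliptic] {p : ℕ} [hp : Fact p.Prime]
  [hint : (W.baseChange ℚ_[p]).IsIntegral ℤ_[p]]

/-- **`#𝓚 = p^m` and a Kummer class of order `p^m`** for `𝓚 = range (localKummerMap)` ⊆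
`H¹(ℚ_p, W[p^m])`, `W/ℚ` elliptic with `p`-integral equation and `W(ℚ_p)[p] = 0`: the logarithm
`padicLog` (kernel = torsion, image a `ℤ_p`-line) gives `#W(ℚ_p)/p^m = p^m` and a point of exact
level `0`, whose Kummer class has order `p^m` (`LocalKummerOrder.addOrderOf_localKummerMap_eq`).
[cite: SilvermanAEC2009, IV.6.4, VII.6.3 and VIII.§2] [cite: GreenbergLNM1716, §2 pp. 62–63] -/
theorem natCard_range_localKummerMap (htors : ∀ X : (W.baseChange ℚ_[p]).toAffine.Point, p • X = 0 → X = 0)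
    (m : ℕ) :
    Nat.card (W.localKummerMap ℚ_[p]
        (show (((p ^ m : ℕ) : ℤ)) ≠ 0 by exact_mod_cast pow_ne_zero m hp.out.ne_zero)).range = p ^ m ∧
      ∃ k ∈ (W.localKummerMap ℚ_[p]
        (show (((p ^ m : ℕ) : ℤ)) ≠ 0 by exact_mod_cast pow_ne_zero m hp.out.ne_zero)).range,
        addOrderOf k = p ^ m := by
  set hn : (((p ^ m : ℕ) : ℤ)) ≠ 0 := by exact_mod_cast pow_ne_zero m hp.out.ne_zero
  haveI : (W.baseChange ℚ_[p]).IsElliptic := inferInstance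
  set X := W.baseChange ℚ_[p] with hX
  set c : ℚ_[p] := (p : ℚ_[p]) ^ ((2 : ℤ) + padicValNat p (Nat.card (AddCommGroup.torsion X.toAffine.Point)) -
    padicValNat p (X.formalFiltration 2).index) with hcdef
  have hc : c ≠ 0 := zpow_ne_zero _ (Nat.cast_ne_zero.mpr hp.out.ne_zero)
  have hrange : ∀ y : ℚ_[p], (∃ a, LocalLog.padicLog X a = y) ↔ ∃ r : ℤ_[p], (r : ℚ_[p]) * c = y := by
    intro y
    have h := LocalLog.range_padicLog_eq_span_zpow X
    constructor
    · rintro ⟨a, rfl⟩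
      have ha : LocalLog.padicLog X a ∈ (LocalLog.padicLog X).range := ⟨a, rfl⟩
      rw [h] at ha
      obtain ⟨r, hr⟩ := Submodule.mem_span_singleton.mp ha
      exact ⟨r, by rw [← hr, Algebra.smul_def]; rfl⟩
    · rintro ⟨r, rfl⟩
      have hy : (r : ℚ_[p]) * c ∈ (LocalLog.padicLog X).range := by
        rw [h]
        refine Submodule.mem_span_singleton.mpr ⟨r, ?_⟩
        rw [Algebra.smul_def]; rfl
      exact hy
  obtain ⟨hcard, a₀, -, ha₀⟩ := natCard_quotient_eq_prime_pow_of_log (LocalLog.padicLog X) hc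
    (fun a ha => (LocalLog.padicLog_eq_zero_iff X a).mp ha) hrange htors m (W.localKummerMap ℚ_[p] hn).ker
    (fun a => by
      rw [W.ker_localKummerMap ℚ_[p] hn, AddMonoidHom.mem_range]
      rfl)
  refine ⟨?_, W.localKummerMap ℚ_[p] hn a₀, ⟨a₀, rfl⟩, ?_⟩
  · exact (Nat.card_congr (QuotientAddGroup.quotientKerEquivRange (W.localKummerMap ℚ_[p] hn)).toEquiv).symm.trans
      hcard
  · have h := LocalKummerOrder.addOrderOf_localKummerMap_eq W ℚ_[p] (ν := 0) (m := m) (Nat.zero_le m)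
      htors (P := a₀) (Q := a₀) (by rw [pow_zero, one_smul]) (fun Q' hQ' => ha₀ Q' (by rwa [zero_add, pow_one] at hQ'))
    rwa [Nat.sub_zero] at h

omit hint in
/-- **The classes of `𝓚` are Kummer cocycles of rational points**: every class in the range of
`localKummerMap` is `[u ↦ uR′ − R′]` with `p^m R′` a `Γ_{ℚ_p}`-fixed point of `W(ℚ̄_p)`
(`localKummerCocycle`, `pointsMap_localKummerCocycle_apply`). [cite: SilvermanAEC2009, VIII.§2] -/
theorem exists_kummer_cocycle_of_mem_range_localKummerMap (κ : ZpExtension ℚ p) (m : ℕ)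
    {ξ : galoisCohomology (GaloisRep.restrictField ℚ_[p] (W.torsionGaloisModule ((p ^ m : ℕ) : ℤ))) 1}
    (hξ : ξ ∈ (W.localKummerMap ℚ_[p]
      (show (((p ^ m : ℕ) : ℤ)) ≠ 0 by exact_mod_cast pow_ne_zero m hp.out.ne_zero)).range) :
    ∃ Q ∈ localLayerPointsOfEmb κ (closureEmb (K := ℚ) ℚ_[p]) W 0,
        ∃ R' : localPoints W ℚ_[p], ((p ^ m : ℕ) : ℤ) • R' = Q ∧
        ∃ φ' : contOneCocycles (DiscreteGaloisModule.toTopRep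
            (GaloisRep.restrictField ℚ_[p] (W.torsionGaloisModule ((p ^ m : ℕ) : ℤ)))),
          oneCocycleClass _ φ' = ξ ∧
          ∀ u : absoluteGaloisGroup ℚ_[p],
            pointsMap W ℚ_[p] ((φ'.1 u : geomTorsion W ((p ^ m : ℕ) : ℤ)) : geomPoints W) = u • R' - R' := by
  set hn : (((p ^ m : ℕ) : ℤ)) ≠ 0 := by exact_mod_cast pow_ne_zero m hp.out.ne_zero
  obtain ⟨P, rfl⟩ := hξ
  set R' := W.localZSMulRoot ℚ_[p] hn P with hR'
  have hfix := W.zsmul_mem_fixedPoints_of_eq ℚ_[p] (W.zsmul_localZSMulRoot ℚ_[p] hn P)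
  refine ⟨((p ^ m : ℕ) : ℤ) • R', ?_, R', rfl, W.localKummerCocycle _ hn R' hfix, rfl,
    fun u => W.pointsMap_localKummerCocycle_apply _ hn R' hfix u⟩
  rw [mem_localLayerPointsOfEmb_zero_iff]
  exact fun τ => hfix τ

end Kummer

/-! ## §3 B3 in level-`m` shape modulo `#H[p] ≤ p²` only -/

section Cyclotomic

variable (W : WeierstrassCurve ℚ) [W.IsElliptic] {p : ℕ} [hp : Fact p.Prime] (κ : ZpExtension ℚ p)
  {V : WeierstrassCurve ℚ} [V.IsElliptic]
  (F : Type) [Field F] [NumberField F] [IsCyclotomicExtension {p} ℚ F]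
  [hint : (W.baseChange ℚ_[p]).IsIntegral ℤ_[p]]

include F in
/-- **B3 IN LEVEL-`m` SHAPE FOR THE `p*`-TWIST, modulo `#H¹(ℚ_p, W[p^m])[p] ≤ p²` ONLY** (Kobayashi's
setting: `F = ℚ(μ_p)`, `κ` cyclotomic, `V = C • W^{(p*)}` with a good supersingular `a_p = 0` model,
`p` odd, `W`'s equation `p`-integral, `2m ≤ n + 1`): with `Σ = closure{minus classes}` and
`𝓚 = range (localKummerMap)` the Kummer group of `W(ℚ_p)`: **`Σ ⊔ 𝓚 = H¹(ℚ_p, W[p^m])`,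
`#Σ = p^m`, `#H¹ = p^{2m}`, and `Σ` has an element of order `p^m`.**
[cite: Kobayashi2003, §3 p. 5, Thm. 6.2 (p. 11), Prop. 8.7 (p. 16), Prop. 8.12 (p. 17), Lemma 8.17 (p. 19)]
[cite: SilvermanAEC2009, IV.6.4, VII.6.3, VIII.§2] -/
theorem closure_minus_sup_range_localKummerMap_eq_top_cyclotomic (hp2 : p ≠ 2) (hκ : κ.IsCyclotomic)
    (C : VariableChange ℚ) (hCV : C • W.quadraticTwist ((-1) ^ (p / 2) * p) = V)
    (M : WeierstrassCurve ℤ_[p]) [hE : (M.map PadicInt.Coe.ringHom).IsElliptic]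
    [hEt : (M.map PadicInt.toZMod).IsElliptic]
    (htr : Literature.NumberTheory.EllipticCurves.HasseManin.tr (M.map PadicInt.toZMod) = 0)
    (hVM : M.baseChange (AlgebraicClosure ℚ_[p]) = V.baseChange (AlgebraicClosure ℚ_[p]))
    {n m : ℕ} (hnm : 2 * m ≤ n + 1)
    (hHp : Nat.card (nsmulAddMonoidHom p : galoisCohomology
        (GaloisRep.restrictField ℚ_[p] (W.torsionGaloisModule ((p ^ m : ℕ) : ℤ))) 1 →+ _).ker ≤ p ^ 2) :
    AddSubgroup.closure {ξ | ∃ x ∈ signedLocalPointsOfEmb κ (closureEmb (K := ℚ) ℚ_[p]) W (-1) n ⊓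
          (localTraceOfEmb κ (closureEmb (K := ℚ) ℚ_[p]) W 0 n).ker,
        ∃ R : localPoints W ℚ_[p], ((p ^ m : ℕ) : ℤ) • R = x ∧
        ∃ φ : contOneCocycles (DiscreteGaloisModule.toTopRep
            (GaloisRep.restrictField ℚ_[p] (W.torsionGaloisModule ((p ^ m : ℕ) : ℤ)))),
          oneCocycleClass _ φ = ξ ∧
          ∀ u ∈ localLayerSubgroupOfEmb κ (closureEmb (K := ℚ) ℚ_[p]) n,
            pointsMap W ℚ_[p] ((φ.1 u : geomTorsion W ((p ^ m : ℕ) : ℤ)) : geomPoints W) = u • R - R} ⊔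
        (W.localKummerMap ℚ_[p]
          (show (((p ^ m : ℕ) : ℤ)) ≠ 0 by exact_mod_cast pow_ne_zero m hp.out.ne_zero)).range = ⊤ ∧
      Nat.card (AddSubgroup.closure {ξ | ∃ x ∈ signedLocalPointsOfEmb κ (closureEmb (K := ℚ) ℚ_[p]) W (-1) n ⊓
          (localTraceOfEmb κ (closureEmb (K := ℚ) ℚ_[p]) W 0 n).ker,
        ∃ R : localPoints W ℚ_[p], ((p ^ m : ℕ) : ℤ) • R = x ∧
        ∃ φ : contOneCocycles (DiscreteGaloisModule.toTopRep
            (GaloisRep.restrictField ℚ_[p] (W.torsionGaloisModule ((p ^ m : ℕ) : ℤ)))),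
          oneCocycleClass _ φ = ξ ∧
          ∀ u ∈ localLayerSubgroupOfEmb κ (closureEmb (K := ℚ) ℚ_[p]) n,
            pointsMap W ℚ_[p] ((φ.1 u : geomTorsion W ((p ^ m : ℕ) : ℤ)) : geomPoints W) = u • R - R}) =
        p ^ m ∧
      Nat.card (galoisCohomology (GaloisRep.restrictField ℚ_[p] (W.torsionGaloisModule ((p ^ m : ℕ) : ℤ))) 1) =
        p ^ (2 * m) ∧
      ∃ s ∈ AddSubgroup.closure {ξ | ∃ x ∈ signedLocalPointsOfEmb κ (closureEmb (K := ℚ) ℚ_[p]) W (-1) n ⊓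
          (localTraceOfEmb κ (closureEmb (K := ℚ) ℚ_[p]) W 0 n).ker,
        ∃ R : localPoints W ℚ_[p], ((p ^ m : ℕ) : ℤ) • R = x ∧
        ∃ φ : contOneCocycles (DiscreteGaloisModule.toTopRep
            (GaloisRep.restrictField ℚ_[p] (W.torsionGaloisModule ((p ^ m : ℕ) : ℤ)))),
          oneCocycleClass _ φ = ξ ∧
          ∀ u ∈ localLayerSubgroupOfEmb κ (closureEmb (K := ℚ) ℚ_[p]) n,
            pointsMap W ℚ_[p] ((φ.1 u : geomTorsion W ((p ^ m : ℕ) : ℤ)) : geomPoints W) = u • R - R},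
        addOrderOf s = p ^ m := by
  obtain ⟨M', hΔ, hA, hVM'⟩ :
      ∃ M' : WeierstrassCurve ℤ_[p], IsUnit M'.Δ ∧ M'.hasseCoeff p ∈ IsLocalRing.maximalIdeal ℤ_[p] ∧
        M'.baseChange (AlgebraicClosure ℚ_[p]) = V.baseChange (AlgebraicClosure ℚ_[p]) :=
    ⟨M, isUnit_Δ_of_isElliptic_toZMod p M, hasseCoeff_mem_maximalIdeal_of_tr_eq_zero hp2 M htr, hVM⟩
  have htorsX := eq_zero_of_prime_smul_eq_zero_padic_of_quadraticTwist_signedPrime hp2 W C hCV M' hΔ hA hVM'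
  obtain ⟨hKcard, k, hk, hkord⟩ := natCard_range_localKummerMap W htorsX m
  exact closure_minus_sup_eq_top_and_card_eq_padic_cyclotomic W κ F hp2 hκ C hCV M htr hVM hnm hHp _
    hKcard ⟨k, hk, hkord⟩ (fun ξ hξ => exists_kummer_cocycle_of_mem_range_localKummerMap W κ m hξ)

end Cyclotomic

end Summit.BirchSwinnertonDyer.Rank1Residual.Additive.SignedTwist

end
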